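import Summits.QuantumFields.BalabanUV.Beta.FP.NestedStepLawTorusTransportedRowsGradedLevelZeroSymULowClosed
import Summits.QuantumFields.BalabanUV.Beta.FP.NestedStepLawTorusTransportedRowsGradedSym
import Summits.QuantumFields.BalabanUV.Beta.FP.PeriodisedFormIndexWardDoubled
import Summits.QuantumFields.BalabanUV.Beta.CombLamSectorPeriodised

/-!
# `BalabanUV.Beta.FP.NestedStepLawTorusTransportedRowsGradedLevelZeroSymULowClosedLam` — road «FP» for binder row D1, ROUTE T, presentation T-β, option (δ)
# «LIFT ∕ GRADED» (R-FP-54′), an2's (J-a) programme item (β), FINAL LEVEL-0 STOREY: **THE GRADED DOOR AT THE (III′) LITERAL, LEVEL `j = 0`, FIRST-ORDER FORM JET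
# = `(−2c) •` leaf-05's PERIODISED WILSON FAMILY `+ w •` an2's PERIODISED Λ-SECTOR FAMILY OF RECORD — `k1 hH₁t` AND THE Λ ROWS `hΛ hΛt` ALL DISCHARGED BY TERM**
# = `…LevelZeroSymULowClosed` (U16′) with `Λ b := w • (perF F (dper F (SLam Lc (lamCoeffOf KInv Lc) (symHessFFAt ρ_c Lc) b.2 ↑b.1)))∘(ff)` PINNED and
# `hΛ := CombLamSectorPeriodised.torus_Lam_indexLaw_fine w λ`, `hΛt := torus_Lam_family_transpose_fine _ w` (an2 g41, (B) of INTENT I-an2-g41-1; junction by `exact`,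
# W-d1leaf02-g21-5).  AFTER IT THE (J-a) (β) DOOR AT LEVEL 0 DISPLAYS ONLY: `k2 q2 hH₂t a2 c2 d2 t2` (order 2), `a1` (between pinned tables), `hdead`, the coarse
# presentation `hfμ′ hcoarse′`, the weight letter `w`, namings and defining equations.  Proof = ONE TERM.  The rest of this docstring is U16′'s.

WHAT.  `NestedStepLawTorusTransportedRowsGradedGenSym.secondVar_oneShot_nestedStepLaw_torus_transported_graded_rows_gen_sym` ((β-b′), leaf-02 g21) is the
(III′) torus call with leaf-02's rows, leaf-06's generator side and `hH₀t` supplied by term; over a FREE first-order form jet `H₁` it displays the GRADED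
form word `k1 : −(XᵀH₀) + H₁ + H₀X = H′₁` and the parity `hH₁t : H₁ᵀ = −H₁` (plus the (γ-sym) sockets `h1 h2` and tables).  At LEVEL `j = 0`:

* the form block: `H₀ = perF F 𝕄_0 ∘ (ff) = perF F (bhKStepAt d (toSite (ctrOff (d+1) Lc)) Lc 0) ∘ (ff)` ((β-b) §0
  `perF_bhKStepSh_Dsh_ff_eq_perF_bhKStepAt`), so leaf-05's ROOTED level-0 producers act at `r := ctrOff (d+1) Lc`:
  `PeriodisedFormIndexWard.torus_k1_sim_letter` (with the DIAGONAL generator `X = (w∕2) • E_λ`: `−X·H₀ + w • W₁^{(h)} + H₀·X = w • W₁^{(h + Dλ)}` for the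
  periodised WILSON family `W₁^{b} := perF F (dper F (wilsonA d b.2 ↑b.1)) ∘ (ff)`) and `PeriodisedFormIndexWardDoubled.torus_H1_transpose` (`(W₁^{(w)})ᵀ = −W₁^{(w)}`);
* leaf-02's rows PIN the generator `X = −c • E_λ`, `c = (Lc^{d+1}·stepScale d Lc 0)⁻¹` (`hX`), so the Wilson half meets `k1` EXACTLY at the weight `w = −2c`
  (as in the rooted p328011);
* the Λ-SECTOR half of the full ff first-order jet (an2 W-an2-g40-6 l.44055: `SLam Lc (lamCoeffOf KInv Lc) H`-type families, exponentially localised, NOT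
  finitely supported — the finite-support §1 exchange of `PeriodisedBorderIndexWard` does not apply; a summable twin is pending) rides as a FREE ADDITIVE
  FAMILY `Λ b` («rows are linear in `H₁`», W-4): `H₁ := (−2c) • Σ_b h b • W₁^{b} + Σ_b h b • Λ b`, `H′₁ :=` the same along `h + Dλ`, and its two rows are
  DISPLAYED — `hΛ : Σ_b (Dλ)_b • Λ b = 0` (the periodised Λ index law; an2: ZERO per site, `CombLamSectorLetters.divV_SLam_lamCoeffOf_an1TablesS2_eq_zero`)
  and `hΛt : (Λ b)ᵀ = −Λ b`.  With them `k1` splits as (Wilson: `torus_k1_sim_letter`) + (Λ: `Σ_b (h + Dλ)_b • Λ b = Σ_b h_b • Λ b` by `hΛ`), and `hH₁t` as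
  `torus_H1_transpose` + `hΛt`.

This file is ONE theorem **`secondVar_oneShot_nestedStepLaw_torus_transported_graded_rows_levelZero_sym`** = the (β-b′) theorem at `j := 0` with `H₁ H′₁`
bound as above (`hH₁ hH'₁` — leaf-05's spellings VERBATIM for the Wilson half), the family `Λ` and its rows `hΛ hΛt` ADDED, and the binders `k1 hH₁t` REMOVED.
Proof = `subst` + ONE TERM.  [folklore] composition BY NAME; nothing of leaf-05's, leaf-06's or the OWNER's restated; no `def`, no `def … : Prop`, nothing
cited, 0 sorry.

WHAT THIS DOES NOT SAY (the dictionary's, an2): whether the (III′) record's level-0 first-order form table along `h` IS `(−2c) •` the periodised Wilson family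
`+` the Λ family the instance will name (located question Q-d1leaf02-g20-1 for the weight; JA-TABLE v1.2 (β) for the slot), and whether that Λ family meets
`hΛ hΛt` — DISPLAYED, not asserted.  What STAYS displayed at level 0: the (γ-sym) sockets `h1 h2` (leaf-05 g29 C3; the closing instance re-displays #12's
`hfμ′ hcoarse′` for `h2`), `k2 q2 hH₂t`, the graded Ward rows `a1 a2` (now between PINNED tables), `c2 d2`, `s1 s2 t2`, `hΛ hΛt`, the namings.

HONEST DEPENDENCY (page 1, mandatory): continuum YM on T⁴ ⇐ BetaPertH ∧ nine spine estimates (0/9 proved); BetaPertH ⇐ (D1) ∧ (D4) ∧ CAP+tail;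
G-an2-4 gates asym, D1 and NE2/3/4.  HONEST FRAMING (cell contract, verbatim): «discharging `BetaPertH` makes Bałaban's UV stability UNCONDITIONAL —
a real constructive-QFT result; it is NOT the continuum limit and NOT the Clay problem.»  ABSOLUTE RULE (cell charter, verbatim): «No internally-minted
statement may enter as a cited fact. Every hypothesis is either kernel-proved in this package or a verbatim quotation of a PUBLISHED theorem with page
reference. The manuscript(s) under audit are NOT citable for their own disputed steps — they are the thing under adjudication; programme-internal
(2001/route/tribunal) claims are never citable.»  0 estimates; 0∕4 row-D1 binders; NOT (T-ID)∕(T-β) complete, NOT (J-a) complete, NOT SDF, NOT D1, NOT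
BetaPertH, NOT continuum, NOT Clay.  Road «FP», D1 formalisation swarm leaf-02 (b2b-balaban-beta-d1-formalise-leaf-02) gen 21, 2026-08-22.  No existing file
touched.
-/

noncomputable section

open scoped BigOperators Matrix

namespace Summit.QuantumFields.BalabanUV.Beta.FP.NestedStepLawTorusTransportedRowsGradedLevelZeroSymULowClosedLam

open Matrix Finset
open Literature.Probability.LatticeModels (Torus.proj)
open Literature.MathematicalPhysics.QuantumFieldTheory.Balaban1983to89
open Literature.MathematicalPhysics.QuantumFieldTheory.Balaban1983to89.Beta
open Literature.MathematicalPhysics.QuantumFieldTheory.Balaban1983to89.Beta.Composition (kkt)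
open Literature.MathematicalPhysics.QuantumFieldTheory.Balaban1983to89.Beta.CompositionSingular (effForm flucCov minOp minOpL)
open Literature.MathematicalPhysics.QuantumFieldTheory.LatticeForm (quo)
open B5Prop11Plancherel (fine)
open B6Lemma24Torus (pbox mem_pbox)
open AffineAveraging (Site box toSite unitVec)
open AveragingContoursRooted (ctr ctrOff ctrOff_mem_box)
open SymAveragingHessianCounts (symVhSAt)
open OneStepResolventKernel (Fib KInv)
open InterLevelTransport (SLam)
open BalabanStepJets (lamCoeffOf)
open Summit.QuantumFields.BalabanUV.Beta.SymAveragingHessianCounts (symHessFFAt)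
open Summit.QuantumFields.BalabanUV.Beta.CombLamSectorPeriodised (torus_Lam_indexLaw_fine torus_Lam_family_transpose_fine)
open Summit.QuantumFields.BalabanUV.Beta.BorderedHessian (bhKStepAt stepScale)
open Summit.QuantumFields.BalabanUV.Beta.DshAn1 (Dsh)
open Summit.QuantumFields.BalabanUV.Beta.SymShiftedSpread (bhKStepSh)
open Summit.QuantumFields.BalabanUV.Beta.D1BFx.LogDetSecondVariation (secondVar)
open Summit.QuantumFields.BalabanUV.Beta.FP.KernelPeriodisationFib (Idx perF)
open Summit.QuantumFields.BalabanUV.Beta.FP.KernelPeriodisationFibLoc (dper)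
open Summit.QuantumFields.BalabanUV.Beta.FP.TorusGaugeCovariance (tdelta tgrad)
open Summit.QuantumFields.BalabanUV.Beta.FP.TorusGaugeCovarianceCoarse (coarsePt tgradBlock)
open Summit.QuantumFields.BalabanUV.Beta.FP.TorusCombRows (Res combRowsT combBondT)
open Summit.QuantumFields.BalabanUV.Beta.FP.TorusCombNestedBasis (resBigEquiv)
open Summit.QuantumFields.BalabanUV.Beta.GAN24.FineReadoutCauchyFrame (toSite_mem_range)
open StepJetData (wilsonA)
open Summit.QuantumFields.BalabanUV.Beta.FP.NestedStepLawTorusTransportedRowsGradedSym (perF_bhKStepSh_Dsh_ff_eq_perF_bhKStepAt)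
open Summit.QuantumFields.BalabanUV.Beta.FP.NestedStepLawTorusTransportedRowsGradedLevelZeroSymULowClosed (secondVar_oneShot_nestedStepLaw_torus_transported_graded_rows_levelZero_sym_uLow_closed)
open Summit.QuantumFields.BalabanUV.Beta.FP.PeriodisedFormIndexWard (torus_k1_sim_letter)
open Summit.QuantumFields.BalabanUV.Beta.FP.PeriodisedFormIndexWardDoubled (torus_H1_transpose)

variable {d : ℕ} (M' : Fin (d + 1) → ℕ) [∀ μ, NeZero (M' μ)] {Lc : ℕ} [NeZero Lc]

set_option synthInstance.maxSize 1024 in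
/-- [folklore] **THE GRADED DOOR AT THE (III′) LITERAL (uLow BOTTOM, SOCKETS CLOSED), LEVEL 0, FULL FIRST-ORDER FORM JET (WILSON `+` Λ): `k1 hH₁t` DISCHARGED BY TERM; displayed only `k2 q2 hH₂t a1 a2 c2 d2 t2 hdead hΛ hΛt hfμ′ hcoarse′` + namings.**
(β-b′)'s `secondVar_oneShot_nestedStepLaw_torus_transported_graded_rows_gen_sym` at `j := 0` with the first-order form jet along `h` bound to
`(−2c) •` leaf-05's periodised Wilson family `+ Σ_b h b • Λ b` (`hH₁`), the one-shot literal's first form jet to the same along `h + Dλ` (`hH'₁`), the weight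
`−2c`, `c = (Lc^{d+1}·stepScale d Lc 0)⁻¹`, being the one the generator pin `X = −c•E_λ` (`hX`) forces; the Λ family's rows `hΛ` (index law along `Dλ`) and
`hΛt` (parity) DISPLAYED; binders `k1 hH₁t` REMOVED — supplied inside by leaf-05's `torus_k1_sim_letter` (at `r := ctrOff`, after (β-b) §0; `Xᵀ = X`) `+ hΛ`,
and `torus_H1_transpose + hΛt`.  Displayed: `h1 h2`, `k2 q2 hH₂t a1 a2 c2 d2`, `s1 s2 t2`, the namings; conclusion VERBATIM the (III′) call's at level 0. -/
theorem secondVar_oneShot_nestedStepLaw_torus_transported_graded_rows_levelZero_sym_uLow_closed_lam (hM' : ∀ i, Lc ∣ M' i)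
    {κ : Type*} [Fintype κ] [DecidableEq κ] (pμ' : κ → ↥(pbox M')) (mμ' : κ → Fin (d + 1))
    (hfμ' : Function.Injective (fun a : κ => ((pμ' a, Sum.inr (mμ' a)) : Idx M' (Fib d))))
    (hcoarse' : ∀ (s : ↥(pbox M')) (m : Fin (d + 1)),
      ((s, Sum.inr m) : Idx M' (Fib d)) ∈ Set.range (fun a : κ => ((pμ' a, Sum.inr (mμ' a)) : Idx M' (Fib d))) ↔ Torus.proj Lc (s : Site (d + 1)) = 0)
    -- the torus objects of record, by defining equations
    {H₀ : Matrix (↥(pbox (fine Lc M')) × Fin (d + 1)) (↥(pbox (fine Lc M')) × Fin (d + 1)) ℝ}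
    {Q₁₀ : Matrix (↥(pbox M') × Fin (d + 1)) (↥(pbox (fine Lc M')) × Fin (d + 1)) ℝ}
    {τ₁ : Matrix (Res (ctr (d + 1) Lc) Lc (fine Lc M')) (↥(pbox (fine Lc M')) × Fin (d + 1)) ℝ}
    {τ₂ : Matrix (Res (ctr (d + 1) Lc) Lc M') (↥(pbox M') × Fin (d + 1)) ℝ}
    {D₁ : Matrix (↥(pbox (fine Lc M')) × Fin (d + 1)) (Res (ctr (d + 1) Lc) Lc (fine Lc M')) ℝ}
    {D₂ : Matrix (↥(pbox (fine Lc M')) × Fin (d + 1)) (Res (ctr (d + 1) Lc) Lc M') ℝ}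
    {Dbar : Matrix (↥(pbox M') × Fin (d + 1)) (Res (ctr (d + 1) Lc) Lc M') ℝ}
    {P : Matrix (Res (ctr (d + 1) Lc) Lc M' ⊕ Res (ctr (d + 1) Lc) Lc (fine Lc M')) (↥(pbox (fine Lc M')) × Fin (d + 1)) ℝ}
    (hH₀ : H₀ = (perF (fine Lc M') (bhKStepSh d Lc (Dsh Lc) 0)).submatrix
        (fun b : ↥(pbox (fine Lc M')) × Fin (d + 1) => ((b.1, Sum.inl b.2) : Idx (fine Lc M') (Fib d)))
        (fun b : ↥(pbox (fine Lc M')) × Fin (d + 1) => ((b.1, Sum.inl b.2) : Idx (fine Lc M') (Fib d))))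
    (hQ₁₀ : Q₁₀ = (perF (fine Lc M') (bhKStepSh d Lc (Dsh Lc) 0)).submatrix
        (fun a : ↥(pbox M') × Fin (d + 1) => ((coarsePt M' Lc a.1, Sum.inr a.2) : Idx (fine Lc M') (Fib d)))
        (fun b : ↥(pbox (fine Lc M')) × Fin (d + 1) => ((b.1, Sum.inl b.2) : Idx (fine Lc M') (Fib d))))
    (hτ₁ : τ₁ = (combRowsT (ctr (d + 1) Lc) Lc (fine Lc M')).submatrix id
        (fun b : ↥(pbox (fine Lc M')) × Fin (d + 1) => ((b.1, Sum.inl b.2) : Idx (fine Lc M') (Fib d))))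
    (hτ₂ : τ₂ = (combRowsT (ctr (d + 1) Lc) Lc M').submatrix id (fun b : ↥(pbox M') × Fin (d + 1) => ((b.1, Sum.inl b.2) : Idx M' (Fib d))))
    (hD₁ : D₁ = (tgrad (fine Lc M')).submatrix (fun b : ↥(pbox (fine Lc M')) × Fin (d + 1) => ((b.1, Sum.inl b.2) : Idx (fine Lc M') (Fib d)))
        (Subtype.val : Res (ctr (d + 1) Lc) Lc (fine Lc M') → ↥(pbox (fine Lc M'))))
    (hD₂ : D₂ = (tgradBlock M' Lc).submatrix (fun b : ↥(pbox (fine Lc M')) × Fin (d + 1) => ((b.1, Sum.inl b.2) : Idx (fine Lc M') (Fib d)))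
        (Subtype.val : Res (ctr (d + 1) Lc) Lc M' → ↥(pbox M')))
    (hDbar : Dbar = Matrix.of fun (a : ↥(pbox M') × Fin (d + 1)) (t : Res (ctr (d + 1) Lc) Lc M') =>
        stepScale d Lc 0 * (((box (d + 1) Lc).card : ℝ) * tgrad M' (a.1, Sum.inl a.2) t.1))
    (hP : P = (combRowsT ((Lc : ℤ) • ctr (d + 1) Lc + ctr (d + 1) Lc) (Lc * Lc) (fine Lc M')).submatrix
        (resBigEquiv Lc Lc (ctr (d + 1) Lc) (ctr (d + 1) Lc) M' (Nat.pos_of_ne_zero (NeZero.ne Lc)) (toSite_mem_range (ctrOff_mem_box (Nat.one_le_iff_ne_zero.mpr (NeZero.ne Lc))))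
          (Nat.pos_of_ne_zero (NeZero.ne Lc)) (toSite_mem_range (ctrOff_mem_box (Nat.one_le_iff_ne_zero.mpr (NeZero.ne Lc))))).symm
        (fun b : ↥(pbox (fine Lc M')) × Fin (d + 1) => ((b.1, Sum.inl b.2) : Idx (fine Lc M') (Fib d))))
    -- the displayed jets: form, averaging (both levels), block covariance, generators (fine and coarse), Ward witnesses
    (H₂ : Matrix (↥(pbox (fine Lc M')) × Fin (d + 1)) (↥(pbox (fine Lc M')) × Fin (d + 1)) ℝ)
    {Q₂₀ : Matrix κ (↥(pbox M') × Fin (d + 1)) ℝ}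
    (hQ₂₀ : Q₂₀ = (perF M' (bhKStepSh d Lc (Dsh Lc) 1)).submatrix (fun a : κ => ((pμ' a, Sum.inr (mμ' a)) : Idx M' (Fib d)))
        (fun b : ↥(pbox M') × Fin (d + 1) => ((b.1, Sum.inl b.2) : Idx M' (Fib d))))
    -- leaf-02's ORDER-1 ROWS ALONG A DIRECTION `h` AND THE GAUGE PARAMETER `λ` OF THE CHART TRANSPORT: the insertion-table families (fine, and coarse
    -- transported by `θ_j·Q₁₀`), the generator jet and the coarse jet by their defining equations (p314580, `PeriodisedCoarseWardContact`, `NestedStepLawTorusInstanceRows`)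
    (h : ↥(pbox (fine Lc M')) × Fin (d + 1) → ℝ) (lam : ↥(pbox (fine Lc M')) → ℝ)
    (Q₁₁ : (↥(pbox (fine Lc M')) × Fin (d + 1) → ℝ) → Matrix (↥(pbox M') × Fin (d + 1)) (↥(pbox (fine Lc M')) × Fin (d + 1)) ℝ)
    (hQ₁₁ : ∀ w, Q₁₁ w = ∑ b : ↥(pbox (fine Lc M')) × Fin (d + 1), w b •
        (perF (fine Lc M') (dper (fine Lc M') (symVhSAt (ctr (d + 1) Lc) d Lc rfl b.2 (b.1 : Site (d + 1))))).submatrix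
          (fun a : ↥(pbox M') × Fin (d + 1) => ((coarsePt M' Lc a.1, Sum.inr a.2) : Idx (fine Lc M') (Fib d)))
          (fun b : ↥(pbox (fine Lc M')) × Fin (d + 1) => ((b.1, Sum.inl b.2) : Idx (fine Lc M') (Fib d))))
    (Q₂₁ : (↥(pbox (fine Lc M')) × Fin (d + 1) → ℝ) → Matrix κ (↥(pbox M') × Fin (d + 1)) ℝ)
    (hQ₂₁ : ∀ w, Q₂₁ w = ∑ b : ↥(pbox (fine Lc M')) × Fin (d + 1), w b •
        ∑ a' : ↥(pbox M') × Fin (d + 1), (stepScale d Lc 1 / (stepScale d Lc 0 ^ 2 * ((box (d + 1) Lc).card : ℝ)) * Q₁₀ a' b) •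
          (perF M' (dper M' (symVhSAt (ctr (d + 1) Lc) d Lc rfl a'.2 (a'.1 : Site (d + 1))))).submatrix (fun a : κ => ((pμ' a, Sum.inr (mμ' a)) : Idx M' (Fib d)))
            (fun b : ↥(pbox M') × Fin (d + 1) => ((b.1, Sum.inl b.2) : Idx M' (Fib d))))
    {W₁ : Matrix (↥(pbox (fine Lc M')) × Fin (d + 1)) (Res (ctr (d + 1) Lc) Lc M' ⊕ Res (ctr (d + 1) Lc) Lc (fine Lc M')) ℝ}
    (hW₁ : W₁ = ∑ b : ↥(pbox (fine Lc M')) × Fin (d + 1), h b •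
        Matrix.of (fun (b' : ↥(pbox (fine Lc M')) × Fin (d + 1)) (e : Res (ctr (d + 1) Lc) Lc M' ⊕ Res (ctr (d + 1) Lc) Lc (fine Lc M')) =>
          if b' = b then
            -((((Lc : ℝ) ^ (d + 1) * stepScale d Lc 0)⁻¹)
              * Sum.elim (fun t : Res (ctr (d + 1) Lc) Lc M' => tdelta M' (quo Lc ((b.1 : Site (d + 1)) + unitVec b.2)) t.1)
                  (fun s : Res (ctr (d + 1) Lc) Lc (fine Lc M') => tdelta (fine Lc M') ((b.1 : Site (d + 1)) + unitVec b.2) s.1) e)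
          else 0))
    {Db₁ : Matrix (↥(pbox M') × Fin (d + 1)) (Res (ctr (d + 1) Lc) Lc M') ℝ}
    (hDb₁ : Db₁ = ∑ b : ↥(pbox (fine Lc M')) × Fin (d + 1), h b •
        Matrix.of fun (a : ↥(pbox M') × Fin (d + 1)) (t : Res (ctr (d + 1) Lc) Lc M') =>
          -((((Lc : ℝ) ^ (d + 1) * stepScale d Lc 0)⁻¹) * Q₁₀ a b * tdelta M' ((a.1 : Site (d + 1)) + unitVec a.2) t.1))
    -- LEVEL 0: the first-order FORM family along `h` IS `(−2c) •` leaf-05's periodised WILSON family (`PeriodisedFormIndexWard`; an3's `wilsonA`),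
    -- the weight `−2c` forced by the generator pin `hX` (displayed binding — the dictionary's identification of the level-0 form slot, not asserted here)
    -- the Λ-SECTOR HALF of the FULL first-order (fields, fields) jet PINNED to an2 g41's Λ family of record (`CombLamSectorPeriodised`, level 0:
    -- `SLam Lc (lamCoeffOf KInv Lc) (symHessFFAt ρ_c Lc)`, periodised on (ff)), at a DISPLAYED weight `w` (the dictionary's normalisation letter)
    (w : ℝ)
    {H₁ : Matrix (↥(pbox (fine Lc M')) × Fin (d + 1)) (↥(pbox (fine Lc M')) × Fin (d + 1)) ℝ}
    (hH₁ : H₁ = ((-2 : ℝ) * (((Lc : ℝ) ^ (d + 1) * stepScale d Lc 0)⁻¹)) • (∑ b : ↥(pbox (fine Lc M')) × Fin (d + 1), h b •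
        (perF (fine Lc M') (dper (fine Lc M') (wilsonA d b.2 (b.1 : Site (d + 1))))).submatrix
          (fun b : ↥(pbox (fine Lc M')) × Fin (d + 1) => ((b.1, Sum.inl b.2) : Idx (fine Lc M') (Fib d)))
          (fun b : ↥(pbox (fine Lc M')) × Fin (d + 1) => ((b.1, Sum.inl b.2) : Idx (fine Lc M') (Fib d))))
      + ∑ b : ↥(pbox (fine Lc M')) × Fin (d + 1), h b •
        (w • (perF (fine Lc M') (dper (fine Lc M')
            (SLam Lc (lamCoeffOf (KInv (N := Lc) (d := d)) Lc) (symHessFFAt (ctr (d + 1) Lc) Lc) b.2 (b.1 : Site (d + 1))))).submatrix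
          (fun b : ↥(pbox (fine Lc M')) × Fin (d + 1) => ((b.1, Sum.inl b.2) : Idx (fine Lc M') (Fib d)))
          (fun b : ↥(pbox (fine Lc M')) × Fin (d + 1) => ((b.1, Sum.inl b.2) : Idx (fine Lc M') (Fib d)))))
    -- the NESTED chart's direction is average-coarse-comb-dead (the hypothesis of `torus_t1_of_average_dead`)
    (hdead : ∀ (a : ↥(pbox M') × Fin (d + 1)) (x : Res (ctr (d + 1) Lc) Lc M'),
      combBondT (ctr (d + 1) Lc) Lc M' x = ((a.1, Sum.inl a.2) : Idx M' (Fib d)) → ∑ b : ↥(pbox (fine Lc M')) × Fin (d + 1), Q₁₀ a b * h b = 0)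
    -- the second-order data stay displayed
    (Q₁₂ : Matrix (↥(pbox M') × Fin (d + 1)) (↥(pbox (fine Lc M')) × Fin (d + 1)) ℝ) (Q₂₂ : Matrix κ (↥(pbox M') × Fin (d + 1)) ℝ)
    -- leaf-06's EXPONENTIAL closed form of the nested chart's generator SECOND jet along `h` (`TorusGeneratorIntertwiningTwo.torus_j2`'s `hW₂`)
    {W₂ : Matrix (↥(pbox (fine Lc M')) × Fin (d + 1)) (Res (ctr (d + 1) Lc) Lc M' ⊕ Res (ctr (d + 1) Lc) Lc (fine Lc M')) ℝ}
    (hW₂ : W₂ = Matrix.of fun (b : ↥(pbox (fine Lc M')) × Fin (d + 1)) (e : Res (ctr (d + 1) Lc) Lc M' ⊕ Res (ctr (d + 1) Lc) Lc (fine Lc M')) =>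
        ((((Lc : ℝ) ^ (d + 1) * stepScale d Lc 0)⁻¹) * h b) ^ 2 * Sum.elim (fun t : Res (ctr (d + 1) Lc) Lc M' => tdelta M' (quo Lc ((b.1 : Site (d + 1)) + unitVec b.2)) t.1)
          (fun s : Res (ctr (d + 1) Lc) Lc (fine Lc M') => tdelta (fine Lc M') ((b.1 : Site (d + 1)) + unitVec b.2) s.1) e)
    (Db₂ : Matrix (↥(pbox M') × Fin (d + 1)) (Res (ctr (d + 1) Lc) Lc M') ℝ)
    (Y₁ Y₂ : Matrix κ (Res (ctr (d + 1) Lc) Lc M' ⊕ Res (ctr (d + 1) Lc) Lc (fine Lc M')) ℝ)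
    -- the chart transport (exponential currency): generators `X` (fields), `X̄` (composite multipliers); the one-shot chart's generator jets `W♯₁ W♯₂`;
    -- the parameter-transport jets `C₁ C₂`
    {X : Matrix (↥(pbox (fine Lc M')) × Fin (d + 1)) (↥(pbox (fine Lc M')) × Fin (d + 1)) ℝ} {Xbar : Matrix κ κ ℝ}
    -- (T-β-1) at the torus: the transport generators ARE the diagonal gauge generators of the parameter `λ` (fields: `−c•E_λ`; composite multipliers: `c•R′_λ̄`)
    (hX : X = -((((Lc : ℝ) ^ (d + 1) * stepScale d Lc 0)⁻¹) • Matrix.diagonal (fun b : ↥(pbox (fine Lc M')) × Fin (d + 1) => lam b.1)))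
    (hXbar : Xbar = (((Lc : ℝ) ^ (d + 1) * stepScale d Lc 0)⁻¹) •
        Matrix.diagonal (fun α : κ => ∑ t : ↥(pbox M'), tdelta M' ((pμ' α : Site (d + 1)) + ctr (d + 1) Lc) t
          * (∑ s : ↥(pbox (fine Lc M')), tdelta (fine Lc M') ((Lc : ℤ) • (t : Site (d + 1)) + ctr (d + 1) Lc) s * lam s)))
    -- (T-β-4) AT THE TORUS (leaf-06 `TorusGeneratorIntertwining`): the one-shot chart's generator first jet IS the nested chart's generator jet ALONG THE
    -- GAUGE-SHIFTED DIRECTION `h + Dλ`, by its defining equation in closed form (`weightedJet_eq` currency)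
    {W'₁ : Matrix (↥(pbox (fine Lc M')) × Fin (d + 1)) (Res (ctr (d + 1) Lc) Lc M' ⊕ Res (ctr (d + 1) Lc) Lc (fine Lc M')) ℝ}
    (hW'₁ : W'₁ = Matrix.of fun (b : ↥(pbox (fine Lc M')) × Fin (d + 1)) (e : Res (ctr (d + 1) Lc) Lc M' ⊕ Res (ctr (d + 1) Lc) Lc (fine Lc M')) =>
        -((((Lc : ℝ) ^ (d + 1) * stepScale d Lc 0)⁻¹) * (h b + ∑ s, tgrad (fine Lc M') (b.1, Sum.inl b.2) s * lam s)
          * Sum.elim (fun t : Res (ctr (d + 1) Lc) Lc M' => tdelta M' (quo Lc ((b.1 : Site (d + 1)) + unitVec b.2)) t.1)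
            (fun s : Res (ctr (d + 1) Lc) Lc (fine Lc M') => tdelta (fine Lc M') ((b.1 : Site (d + 1)) + unitVec b.2) s.1) e))
    -- the one-shot chart's generator SECOND jet along `h + Dλ`, exponential closed form (`torus_j2`'s `hW₂'`, `torus_uP_exp`'s `hW₂` at `w := h + Dλ`)
    {W'₂ : Matrix (↥(pbox (fine Lc M')) × Fin (d + 1)) (Res (ctr (d + 1) Lc) Lc M' ⊕ Res (ctr (d + 1) Lc) Lc (fine Lc M')) ℝ}
    (hW'₂ : W'₂ = Matrix.of fun (b : ↥(pbox (fine Lc M')) × Fin (d + 1)) (e : Res (ctr (d + 1) Lc) Lc M' ⊕ Res (ctr (d + 1) Lc) Lc (fine Lc M')) =>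
        ((((Lc : ℝ) ^ (d + 1) * stepScale d Lc 0)⁻¹) * (h b + ∑ s, tgrad (fine Lc M') (b.1, Sum.inl b.2) s * lam s)) ^ 2
          * Sum.elim (fun t : Res (ctr (d + 1) Lc) Lc M' => tdelta M' (quo Lc ((b.1 : Site (d + 1)) + unitVec b.2)) t.1)
            (fun s : Res (ctr (d + 1) Lc) Lc (fine Lc M') => tdelta (fine Lc M') ((b.1 : Site (d + 1)) + unitVec b.2) s.1) e)
    -- the parameter-transport GENERATOR `C₁(λ)` by leaf-06's defining equation `hC₁` VERBATIM («multiplication by `λ` in the gauge-mode basis»: `diagonal λ̄`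
    -- on the coarse residual parameters, `diagonal (λ∘val)` on the fine ones, coarse-to-fine block `(λ s − λ̄ t)·[block s = t]`); the transport is `c • C₁`
    {C₁ : Matrix (Res (ctr (d + 1) Lc) Lc M' ⊕ Res (ctr (d + 1) Lc) Lc (fine Lc M')) (Res (ctr (d + 1) Lc) Lc M' ⊕ Res (ctr (d + 1) Lc) Lc (fine Lc M')) ℝ}
    (hC₁ : C₁ = Matrix.fromBlocks
        (Matrix.diagonal fun t : Res (ctr (d + 1) Lc) Lc M' =>
          ∑ s, tdelta (fine Lc M') ((Lc : ℤ) • ((t.1 : ↥(pbox M')) : Site (d + 1)) + ctr (d + 1) Lc) s * lam s)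
        (0 : Matrix (Res (ctr (d + 1) Lc) Lc M') (Res (ctr (d + 1) Lc) Lc (fine Lc M')) ℝ)
        (Matrix.of fun (s : Res (ctr (d + 1) Lc) Lc (fine Lc M')) (t : Res (ctr (d + 1) Lc) Lc M') =>
          (lam s.1 - ∑ s', tdelta (fine Lc M') ((Lc : ℤ) • ((t.1 : ↥(pbox M')) : Site (d + 1)) + ctr (d + 1) Lc) s' * lam s')
            * tdelta M' (quo Lc ((s.1 : ↥(pbox (fine Lc M'))) : Site (d + 1))) t.1)
        (Matrix.diagonal fun s : Res (ctr (d + 1) Lc) Lc (fine Lc M') => lam s.1))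
    {𝔔₀ 𝔔₁ 𝔔₂ : Matrix κ (↥(pbox (fine Lc M')) × Fin (d + 1)) ℝ}
    (h𝔔₀ : Q₂₀ * Q₁₀ = 𝔔₀) (h𝔔₁ : Q₂₁ h * Q₁₀ + Q₂₀ * Q₁₁ h = 𝔔₁)
    (h𝔔₂ : Q₂₂ * Q₁₀ + Q₂₁ h * Q₁₁ h + (Q₂₁ h * Q₁₁ h + Q₂₀ * Q₁₂) = 𝔔₂)
    -- (T-β-1) GRADED: the ONE-SHOT literal's composite jets are the graded `X`-conjugated words of the nested-chart jets (`𝔎 = H`: δ-constrained), NAMED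
    {H'₂ : Matrix (↥(pbox (fine Lc M')) × Fin (d + 1)) (↥(pbox (fine Lc M')) × Fin (d + 1)) ℝ}
    -- LEVEL 0: the ONE-SHOT literal's first form jet IS the same weighted Wilson family along the GAUGE-SHIFTED direction `h + Dλ` (`k1` DISCHARGED:
    -- leaf-05 `torus_k1_sim_letter`)
    {H'₁ : Matrix (↥(pbox (fine Lc M')) × Fin (d + 1)) (↥(pbox (fine Lc M')) × Fin (d + 1)) ℝ}
    (hH'₁ : H'₁ = ((-2 : ℝ) * (((Lc : ℝ) ^ (d + 1) * stepScale d Lc 0)⁻¹)) • (∑ b : ↥(pbox (fine Lc M')) × Fin (d + 1),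
        (h b + ∑ s : ↥(pbox (fine Lc M')), tgrad (fine Lc M') (b.1, Sum.inl b.2) s * lam s) •
          (perF (fine Lc M') (dper (fine Lc M') (wilsonA d b.2 (b.1 : Site (d + 1))))).submatrix
          (fun b : ↥(pbox (fine Lc M')) × Fin (d + 1) => ((b.1, Sum.inl b.2) : Idx (fine Lc M') (Fib d)))
          (fun b : ↥(pbox (fine Lc M')) × Fin (d + 1) => ((b.1, Sum.inl b.2) : Idx (fine Lc M') (Fib d))))
      + ∑ b : ↥(pbox (fine Lc M')) × Fin (d + 1), (h b + ∑ s : ↥(pbox (fine Lc M')), tgrad (fine Lc M') (b.1, Sum.inl b.2) s * lam s) •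
        (w • (perF (fine Lc M') (dper (fine Lc M')
            (SLam Lc (lamCoeffOf (KInv (N := Lc) (d := d)) Lc) (symHessFFAt (ctr (d + 1) Lc) Lc) b.2 (b.1 : Site (d + 1))))).submatrix
          (fun b : ↥(pbox (fine Lc M')) × Fin (d + 1) => ((b.1, Sum.inl b.2) : Idx (fine Lc M') (Fib d)))
          (fun b : ↥(pbox (fine Lc M')) × Fin (d + 1) => ((b.1, Sum.inl b.2) : Idx (fine Lc M') (Fib d)))))
    {𝔔'₁ 𝔔'₂ : Matrix κ (↥(pbox (fine Lc M')) × Fin (d + 1)) ℝ}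
    -- `q1` DISCHARGED (`PeriodisedCompositeIndexWard.torus_q1_letter`): the one-shot literal's first composite averaging jet IS the composite insertion jet
    -- along the GAUGE-SHIFTED direction `h + Dλ`, NAMED
    (h𝔔'₁ : Q₂₁ (fun b => h b + ∑ s : ↥(pbox (fine Lc M')), tgrad (fine Lc M') (b.1, Sum.inl b.2) s * lam s) * Q₁₀
        + Q₂₀ * Q₁₁ (fun b => h b + ∑ s : ↥(pbox (fine Lc M')), tgrad (fine Lc M') (b.1, Sum.inl b.2) s * lam s) = 𝔔'₁)
    (k2 : (X * X)ᵀ * H₀ + (-(Xᵀ * H₁) + -(Xᵀ * H₀ * X)) + ((-(Xᵀ * H₁) + -(Xᵀ * H₀ * X)) + (H₂ + H₁ * X + (H₁ * X + H₀ * (X * X)))) = H'₂)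
    (q2 : Xbar * Xbar * 𝔔₀ + (Xbar * 𝔔₁ + Xbar * 𝔔₀ * X) + ((Xbar * 𝔔₁ + Xbar * 𝔔₀ * X) + (𝔔₂ + 𝔔₁ * X + (𝔔₁ * X + 𝔔₀ * (X * X)))) = 𝔔'₂)
    -- (T-β-4) `j1 j2 uC` and the one-shot (UNI)-jet letter `uP'` DISCHARGED (leaf-06); dead rows of the nested chart stay: the small comb rows, and
    -- the order-2 coarse comb row of the average (`t1` DISCHARGED)
    (t2 : τ₂ * (Q₁₂ * fromCols D₂ D₁ + (2 : ℝ) • (Q₁₁ h * W₁) + Q₁₀ * W₂) = 0)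
    -- the parity of the displayed SECOND form jet (`H₀ᵀ = H₀` discharged inside the graded call by `torus_H₀_transpose`; `H₁ᵀ = −H₁` DISCHARGED here by
    -- leaf-05's `torus_H1_transpose`)
    (hH₂t : H₂ᵀ = H₂)
    -- the GRADED second-order composite Ward TABLE IDENTITIES (δ-constrained: `𝔎 = H`; the door's one-sided graded shapes, `W₀ := [D₂ | D₁]`), read at
    -- `Y₀ = 0`; orders 1 and 2 only (order 0 `a0` DISCHARGED: `PeriodisedWardOrderZero.torus_a0_letter`); NO transposed rows
    (a1 : H₁ * fromCols D₂ D₁ + H₀ * W₁ = 𝔔₀ᵀ * Y₁)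
    (a2 : H₂ * fromCols D₂ D₁ + (2 : ℝ) • (H₁ * W₁) + H₀ * W₂ = -((2 : ℝ) • (𝔔₁ᵀ * Y₁)) + 𝔔₀ᵀ * Y₂)
    -- the insertion-table covariance TABLE IDENTITIES and the coarse covariance identities (order 0 discharged in p316503)
    -- order 2 only (order 1 `c1 d1` DISCHARGED: p314580, `PeriodisedCoarseWardContact`)
    (c2 : Q₁₂ * fromCols D₂ D₁ + (2 : ℝ) • (Q₁₁ h * W₁) + Q₁₀ * W₂ = fromCols Db₂ 0)
    (d2 : Q₂₂ * Dbar + (2 : ℝ) • (Q₂₁ h * Db₁) + Q₂₀ * Db₂ = 0)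
    -- block namings and the coarse non-degeneracy
    {Γ : Matrix (↥(pbox (fine Lc M')) × Fin (d + 1)) (↥(pbox (fine Lc M')) × Fin (d + 1)) ℝ}
    {I : Matrix (↥(pbox (fine Lc M')) × Fin (d + 1)) ((↥(pbox M') × Fin (d + 1)) ⊕ Res (ctr (d + 1) Lc) Lc (fine Lc M')) ℝ}
    {L : Matrix ((↥(pbox M') × Fin (d + 1)) ⊕ Res (ctr (d + 1) Lc) Lc (fine Lc M')) (↥(pbox (fine Lc M')) × Fin (d + 1)) ℝ}
    {S : Matrix ((↥(pbox M') × Fin (d + 1)) ⊕ Res (ctr (d + 1) Lc) Lc (fine Lc M')) ((↥(pbox M') × Fin (d + 1)) ⊕ Res (ctr (d + 1) Lc) Lc (fine Lc M')) ℝ}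
    {B : Matrix ((↥(pbox M') × Fin (d + 1)) ⊕ Res (ctr (d + 1) Lc) Lc (fine Lc M')) (↥(pbox (fine Lc M')) × Fin (d + 1)) ℝ}
    (hΓ : flucCov H₀ (fromRows Q₁₀ τ₁) = Γ) (hI : minOp H₀ (fromRows Q₁₀ τ₁) = I) (hL : minOpL H₀ (fromRows Q₁₀ τ₁) = L) (hS : effForm H₀ (fromRows Q₁₀ τ₁) = S)
    (hB : fromRows (Q₁₁ h) (0 : Matrix (Res (ctr (d + 1) Lc) Lc (fine Lc M')) (↥(pbox (fine Lc M')) × Fin (d + 1)) ℝ) = B) :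
    secondVar (kkt H₀ (fromRows 𝔔₀ P))
        (fromBlocks H'₁ (-(fromRows 𝔔'₁ (0 : Matrix (Res (ctr (d + 1) Lc) Lc M' ⊕ Res (ctr (d + 1) Lc) Lc (fine Lc M')) (↥(pbox (fine Lc M')) × Fin (d + 1)) ℝ))ᵀ)
          (fromRows 𝔔'₁ (0 : Matrix (Res (ctr (d + 1) Lc) Lc M' ⊕ Res (ctr (d + 1) Lc) Lc (fine Lc M')) (↥(pbox (fine Lc M')) × Fin (d + 1)) ℝ)) 0)
        (kkt H'₂ (fromRows 𝔔'₂ (0 : Matrix (Res (ctr (d + 1) Lc) Lc M' ⊕ Res (ctr (d + 1) Lc) Lc (fine Lc M')) (↥(pbox (fine Lc M')) × Fin (d + 1)) ℝ)))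
      = secondVar (kkt H₀ (fromRows Q₁₀ τ₁)) (fromBlocks H₁ (-Bᵀ) B 0)
            (kkt H₂ (fromRows Q₁₂ (0 : Matrix (Res (ctr (d + 1) Lc) Lc (fine Lc M')) (↥(pbox (fine Lc M')) × Fin (d + 1)) ℝ)))
        + secondVar
            (kkt S.toBlocks₁₁ (fromRows Q₂₀ τ₂))
            (fromBlocks ((L * H₁ - S * B) * I + L * Bᵀ * S).toBlocks₁₁ (-(fromRows (Q₂₁ h) (0 : Matrix (Res (ctr (d + 1) Lc) Lc M') (↥(pbox M') × Fin (d + 1)) ℝ))ᵀ)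
              (fromRows (Q₂₁ h) (0 : Matrix (Res (ctr (d + 1) Lc) Lc M') (↥(pbox M') × Fin (d + 1)) ℝ)) 0)
            (kkt (((-((L * H₁ - S * B) * Γ - L * Bᵀ * L) * H₁ + L * H₂
                      - (((L * H₁ - S * B) * I + L * Bᵀ * S) * B
                          + S * fromRows Q₁₂ (0 : Matrix (Res (ctr (d + 1) Lc) Lc (fine Lc M')) (↥(pbox (fine Lc M')) × Fin (d + 1)) ℝ))) * I
                    + (L * H₁ - S * B) * (-((Γ * H₁ + I * B) * I + Γ * Bᵀ * S)))
                  - ((-((L * H₁ - S * B) * Γ - L * Bᵀ * L) * (-Bᵀ)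
                        + L * (fromRows Q₁₂ (0 : Matrix (Res (ctr (d + 1) Lc) Lc (fine Lc M')) (↥(pbox (fine Lc M')) × Fin (d + 1)) ℝ))ᵀ) * S
                      + L * (-Bᵀ) * ((L * H₁ - S * B) * I + L * Bᵀ * S))).toBlocks₁₁
              (fromRows Q₂₂ (0 : Matrix (Res (ctr (d + 1) Lc) Lc M') (↥(pbox M') × Fin (d + 1)) ℝ))) :=
  secondVar_oneShot_nestedStepLaw_torus_transported_graded_rows_levelZero_sym_uLow_closed M' hM' pμ' mμ' hfμ' hcoarse' hH₀ hQ₁₀ hτ₁ hτ₂ hD₁ hD₂ hDbar hP H₂ hQ₂₀ h lam Q₁₁ hQ₁₁ Q₂₁ hQ₂₁ hW₁ hDb₁ (fun b : ↥(pbox (fine Lc M')) × Fin (d + 1) =>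
      (w • (perF (fine Lc M') (dper (fine Lc M')
              (SLam Lc (lamCoeffOf (KInv (N := Lc) (d := d)) Lc) (symHessFFAt (ctr (d + 1) Lc) Lc) b.2 (b.1 : Site (d + 1))))).submatrix
            (fun b : ↥(pbox (fine Lc M')) × Fin (d + 1) => ((b.1, Sum.inl b.2) : Idx (fine Lc M') (Fib d)))
            (fun b : ↥(pbox (fine Lc M')) × Fin (d + 1) => ((b.1, Sum.inl b.2) : Idx (fine Lc M') (Fib d))))) hH₁ hdead Q₁₂ Q₂₂ hW₂ Db₂ Y₁ Y₂ hX hXbar hW'₁ hW'₂ hC₁ h𝔔₀ h𝔔₁ h𝔔₂ hH'₁ (torus_Lam_indexLaw_fine (M' := M') w lam) (fun b => torus_Lam_family_transpose_fine (M' := M') _ w b) h𝔔'₁ k2 q2 t2 hH₂t a1 a2 c2 d2 hΓ hI hL hS hB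

end Summit.QuantumFields.BalabanUV.Beta.FP.NestedStepLawTorusTransportedRowsGradedLevelZeroSymULowClosedLam

end
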